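import Literature.NumberTheory.Automorphic.CDTTheorem712
import Literature.NumberTheory.Automorphic.CDTTheorem722
import Literature.NumberTheory.EllipticCurves.Szpiro
import Literature.NumberTheory.EllipticCurves.CMNewformOfHeckeCharacter
import Literature.NumberTheory.DiophantineGeometry.GeneralizedFermatTwoPowerCoefficientExponentThree
import Mathlib.GroupTheory.PGroup
import HarnessLib

/-!
# STUB-IDEAS `stub_modThree` · ideator k1 · GENERATION 7 — companion sketch (helper signatures)

Crux `FreyModularity` (stmt-ABC-11340), line `Lines/Sketch.lean`.  This file types the helper lemmas of
`STUB-IDEAS-stub_modThree-1.md` (gen 7): PLAN F ("the Frey family never meets the dihedral half of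
Langlands–Tunnell": `3 ∤ #im ρ̄_{E,3} ⇒ Δ_E ∈ ℚ׳ ⇒ abc = 2s³ ⇒ Euler ⇒ CM corner`) and PLAN D⁷ (the
2-group branch of the stub AS TYPED from the vendored weight-`≥ 2` CM-newform fact).  `sorry` only in
helper stubs; every composition is kernel-checked.
-/

noncomputable section

open scoped MatrixGroups NumberField Polynomial
open NumberField IsDedekindDomain Polynomial CongruenceSubgroup Field
open Literature.NumberTheory.EllipticCurves
open Literature.NumberTheory.EllipticCurves.ModularForms
open Literature.NumberTheory.Automorphic
open Literature.NumberTheory.Automorphic.BCDT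
open Literature.NumberTheory.GaloisRepresentations
open Literature.NumberTheory.DiophantineGeometry
open WeierstrassCurve

namespace Summit.ABC.ABC.Cruxes.FreyModularity.Sketch.StubModThreeIdeasK1G7

/-! ## The registered stub and its two halves -/

/-- The registered stub S1a, verbatim. -/
def StubModThree : Prop :=
  ∀ (W : WeierstrassCurve ℚ) [W.IsElliptic] (ρ : ModPGaloisRep ℚ (ZMod 3) 2),
    W.IsTorsionGaloisRep 3 ρ → FramedRep.IsAbsolutelyIrreducible ρ → ρ.IsModular

/-- **F5 / the surjective half** — Langlands–Tunnell for `ρ̄_{E,3}` ONTO `GL₂(𝔽₃)` only (octahedral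
type after `Ψ`; k1 gen 6 `o1_of_helpers`): the only half the Frey line consumes (PLAN F). -/
def StubModThreeSurj : Prop :=
  ∀ (W : WeierstrassCurve ℚ) [W.IsElliptic] (ρ : ModPGaloisRep ℚ (ZMod 3) 2),
    W.IsTorsionGaloisRep 3 ρ → Function.Surjective ρ → ρ.IsModular

/-- **The 2-group (Cartan-normaliser / dihedral-type) half** of the stub as typed. -/
def TwoGroupBranch : Prop :=
  ∀ (W : WeierstrassCurve ℚ) [W.IsElliptic] (ρ : ModPGaloisRep ℚ (ZMod 3) 2),
    W.IsTorsionGaloisRep 3 ρ → FramedRep.IsAbsolutelyIrreducible ρ →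
    IsPGroup 2 ρ.toMonoidHom.range → ρ.IsModular

/-- **H0** (PROVED, k1 gen 2 companion `STUB_IDEAS_stub_modThree_1.lean`; restated): `ρ̄_{E,3}` is odd
(Weil pairing: `det ρ̄ = χ̄₃`, `χ̄₃(c) = -1`). -/
theorem isOdd_of_isTorsionGaloisRep_three (W : WeierstrassCurve ℚ) [W.IsElliptic]
    (ρ : ModPGaloisRep ℚ (ZMod 3) 2) (hρ : W.IsTorsionGaloisRep 3 ρ) : FramedGaloisRep.IsOdd ρ := by
  sorry

/-- **N1** (PROVED, k1 gen 5/6 companion `STUB_IDEAS_stub_modThree_1_g6.lean` l. 421; restated):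
Serre 1972 Prop. 15 in `GL₂(𝔽₃)` — an irreducible odd `ρ̄` is onto or has image a `2`-group. -/
theorem surjective_or_isPGroup_two (ρ : ModPGaloisRep ℚ (ZMod 3) 2)
    (hirr : FramedRep.IsIrreducible ρ) (hodd : FramedGaloisRep.IsOdd ρ) :
    Function.Surjective ρ ∨ IsPGroup 2 ρ.toMonoidHom.range := by
  sorry

/-- The stub is the conjunction of its two halves (kernel-checked modulo H0, N1 — both proved elsewhere). -/
theorem stubModThree_of_surj_of_twoGroup (hS : StubModThreeSurj) (hT : TwoGroupBranch) :
    StubModThree := by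
  intro W _ ρ hρ habs
  rcases surjective_or_isPGroup_two ρ habs.isIrreducible (isOdd_of_isTorsionGaloisRep_three W ρ hρ)
    with hs | h2
  · exact hS W ρ hρ hs
  · exact hT W ρ hρ habs h2

/-! ## PLAN F — `Δ_E ∈ ℚ׳` on the 2-group branch, and Euler's `X³ + Y³ = 2Z³` at the Frey corner -/

/-- **F1a** (resolvent-cubic identity, S, pure algebra — PROVED): for the roots `x₁ … x₄` of the
`3`-division polynomial `ψ₃ = 3x⁴ + 6Ax² + 12Bx − A²` of `y² = x³ + Ax + B` (Vieta hypotheses), the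
pairing resolvent `θ = x₁x₂ + x₃x₄` satisfies `(2A − 3θ)³ = Δ = −16(4A³ + 27B²)`: the resolvent cubic
of `ψ₃` is the PURE cubic `(θ − 2A/3)³ + Δ/27`.  (Diamond–Kramer, CSS 1997 appendix, p. 583 of the
PDF: "`L_X = K(X(E[3]))` contains `K₁ = K(μ₃, Δ^{1/3})`, `Gal(L_X/K₁) ↪ ℤ/2 ⊕ ℤ/2`".) -/
theorem resolvent_cube {F : Type*} [CommRing F] (x₁ x₂ x₃ x₄ A B : F)
    (h₁ : x₁ + x₂ + x₃ + x₄ = 0)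
    (h₂ : x₁ * x₂ + x₁ * x₃ + x₁ * x₄ + x₂ * x₃ + x₂ * x₄ + x₃ * x₄ = 2 * A)
    (h₃ : x₁ * x₂ * x₃ + x₁ * x₂ * x₄ + x₁ * x₃ * x₄ + x₂ * x₃ * x₄ = -4 * B)
    (h₄ : 3 * (x₁ * x₂ * x₃ * x₄) = -A ^ 2) :
    (2 * A - 3 * (x₁ * x₂ + x₃ * x₄)) ^ 3 = -16 * (4 * A ^ 3 + 27 * B ^ 2) := by
  linear_combination
    (-27 * (-(x₁ * x₂ * x₃ + x₁ * x₂ * x₄ + x₁ * x₃ * x₄ + x₂ * x₃ * x₄) * (x₁ * x₂ + x₃ * x₄) +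
        (x₁ + x₂ + x₃ + x₄) * (x₁ * x₂ * x₃ * x₄))) * h₁ +
      (-27 * (x₁ * x₂ + x₃ * x₄) ^ 2 - 36 * A ^ 2) * h₂ +
      (-27 * ((x₁ * x₂ * x₃ + x₁ * x₂ * x₄ + x₁ * x₃ * x₄ + x₂ * x₃ * x₄) - 4 * B)) * h₃ +
      (-36 * ((x₁ * x₂ + x₃ * x₄) -
        (x₁ * x₂ + x₁ * x₃ + x₁ * x₄ + x₂ * x₃ + x₂ * x₄ + x₃ * x₄))) * h₄

/-- **F1** (M, new arithmetic helper; Diamond–Kramer loc. cit., Serre 1972 §5.3): if the image of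
`ρ̄_{E,3}` is a `2`-group then `Δ_E` is a rational cube.  Proof plan: pass to a short model (same `Δ`
up to the 12th power of a unit — `VariableChange`), the `8` points of order `3` have the `4` distinct
roots of `ψ₃` as `x`-coordinates (`addOrderOf_eq_three_iff_Ψ₃_eval_eq_zero`, `card E[3] = 9`); a
`2`-group `H ≤ GL₂(𝔽₃)` acting on the `3`-set of pairings of `ℙ¹(𝔽₃)` has a fixed pairing
(`IsPGroup.card_modEq_card_fixedPoints`, `3` odd); its resolvent `θ` is `Γ_ℚ`-invariant (the frame
`e` of `IsTorsionGaloisRep` transports `σ • P` to `ρ̄ σ · e P`), hence rational, and F1a gives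
`Δ = (2A − 3θ)³`. -/
theorem isCube_Δ_of_isPGroup_two (W : WeierstrassCurve ℚ) [W.IsElliptic]
    (ρ : ModPGaloisRep ℚ (ZMod 3) 2) (hρ : W.IsTorsionGaloisRep 3 ρ)
    (h2 : IsPGroup 2 ρ.toMonoidHom.range) : ∃ t : ℚ, W.Δ = t ^ 3 := by
  sorry

/-- The six CM corner pairs of the Frey family (`{|a|, |b|, |a+b|} = {1, 1, 2}`; all six curves are
translates of `y² = x³ − x`, `j = 1728`, `N = 32`). -/
def IsCorner (a b : ℤ) : Prop :=
  (a = 1 ∧ b = 1) ∨ (a = -1 ∧ b = -1) ∨ (a = 1 ∧ b = -2) ∨ (a = -1 ∧ b = 2) ∨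
    (a = 2 ∧ b = -1) ∨ (a = -2 ∧ b = 1)

/-- **F2a** (S, elementary): `16 n² = t³` in `ℚ` with `n ∈ ℤ ∖ {0}` forces `n = ±2s³`
(`t` is an integer root of `X³ − 16n²`; compare `2`-adic and odd valuations). -/
theorem eq_two_mul_cube_of_sixteen_mul_sq {n : ℤ} (hn : n ≠ 0) {t : ℚ}
    (h : (16 : ℚ) * (n : ℚ) ^ 2 = t ^ 3) : ∃ s : ℤ, n = 2 * s ^ 3 ∨ n = -(2 * s ^ 3) := by
  sorry

/-- **F2b** (S, elementary + Euler IN THE TREE): coprime `a, b` with `ab(a+b) = ±2s³ ≠ 0` are a corner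
pair — the three pairwise coprime factors are `±`cubes except one `±2·`cube
(`Int.eq_pow_of_mul_eq_pow_odd`, as in the tree's `exists_eq_pow_three_of_mul_eq_pow_three`), and
`a + b = c` becomes `x³ + 2y³ + z³ = 0`, settled by the tree's `denesEquation_three`
(Euler 1770, `eq_or_eq_zero_of_cube_add_cube_eq_two_mul_cube`). -/
theorem isCorner_of_mul_eq_two_mul_cube {a b s : ℤ} (hab : IsCoprime a b) (h0 : a * b * (a + b) ≠ 0)
    (h : a * b * (a + b) = 2 * s ^ 3 ∨ a * b * (a + b) = -(2 * s ^ 3)) : IsCorner a b := by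
  sorry

/-- **F2** (assembly of F2a–F2b with `freyCurve_Δ : Δ(E_{a,b}) = 16 (ab(a+b))²` — PROVED modulo F2a/F2b). -/
theorem isCorner_of_isCube_Δ_freyCurve {a b : ℤ} (hab : IsCoprime a b) (h0 : a * b * (a + b) ≠ 0)
    (ht : ∃ t : ℚ, (freyCurve a b).Δ = t ^ 3) : IsCorner a b := by
  obtain ⟨t, ht⟩ := ht
  rw [freyCurve_Δ] at ht
  obtain ⟨s, hs⟩ := eq_two_mul_cube_of_sixteen_mul_sq (n := a * b * (a + b)) h0
    (t := t) (by push_cast; linear_combination ht)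
  exact isCorner_of_mul_eq_two_mul_cube hab h0 hs

/-- **F4** (S): the six corner curves are modular — S13 (`Summit.ABC.ABC.Theorems.stub_freyModularityCorner`,
landed p158543: the crux body at `(1, -2)`, i.e. `y² = x³ − x` of conductor `32`) transported along the
translations `x ↦ x + r` identifying the six models (`BCDT.IsModular` is isomorphism-invariant: same
`L`-series coefficients and conductor). -/
theorem isModular_freyCurve_of_isCorner {a b : ℤ} (h : IsCorner a b)
    [NeZero ((freyCurve a b).conductorNorm ℤ)] :
    haveI := isElliptic_freyCurve (a := a) (b := b) (by
      rcases h with ⟨rfl, rfl⟩ | ⟨rfl, rfl⟩ | ⟨rfl, rfl⟩ | ⟨rfl, rfl⟩ | ⟨rfl, rfl⟩ | ⟨rfl, rfl⟩ <;> decide)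
    BCDT.IsModular (freyCurve a b) := by
  sorry

/-- **F3** (S, PROVED here): the from-a-curve SURJECTIVE `3`–`5` switch is an instance of the tree's named
fact `BCDT.exists_isTorsionGaloisRep_five_and_surjective_three` (BCDT 2001 §2.2 / Taylor 1997 p. 344 /
Wiles 1995 Ch. 5) — the form of `stub_switch` in reshapes 1–3 of the line. -/
theorem switch_surjective_of_SBT (hE : exists_isTorsionGaloisRep_five_and_surjective_three) :
    ∀ (W : WeierstrassCurve ℚ) [W.IsElliptic] (ρ : ModPGaloisRep ℚ (ZMod 5) 2),
      W.IsTorsionGaloisRep 5 ρ → ρ.IsAbsIrreducibleOverSqrt 5 →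
      ∃ (W' : WeierstrassCurve ℚ) (_ : W'.IsElliptic), W'.IsTorsionGaloisRep 5 ρ ∧
        ∃ ρ₃' : ModPGaloisRep ℚ (ZMod 3) 2, W'.IsTorsionGaloisRep 3 ρ₃' ∧ Function.Surjective ρ₃' := by
  intro W _ ρ hρ h5
  exact hE ρ h5.isAbsolutelyIrreducible (W.det_eq_modPCyclotomicCharacter_of_isTorsionGaloisRep_holds 5 ρ hρ)

/-- **`liftThree` in surjective form** (PROVED, = the skeleton's `liftThree_of_stubs` with S1a replaced by
its surjective half; `Surjective ⇒` absolutely irreducible over `ℚ(√-3)` is the tree's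
`isAbsIrreducibleOverSqrt_neg_three_of_surjective`). -/
theorem liftThree_of_surjStubs (hmod3 : StubModThreeSurj)
    (hlift3 : ∀ (W : WeierstrassCurve ℚ) [W.IsElliptic] (ρ : ModPGaloisRep ℚ (ZMod 3) 2),
      W.IsTorsionGaloisRep 3 ρ → ρ.IsAbsIrreducibleOverSqrt (-3) → ¬ 9 ∣ W.conductorNorm ℤ →
      ρ.IsModular → W.IsModularGaloisRepTate 3)
    (h32 : ∀ (W : WeierstrassCurve ℚ) [W.IsElliptic] [NeZero (W.conductorNorm ℤ)] (ℓ : ℕ)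
      [Fact ℓ.Prime], W.IsModularGaloisRepTate ℓ → BCDT.IsModular W) :
    ∀ (W : WeierstrassCurve ℚ) [W.IsElliptic] [NeZero (W.conductorNorm ℤ)]
      (ρ : ModPGaloisRep ℚ (ZMod 3) 2), W.IsTorsionGaloisRep 3 ρ →
      Function.Surjective ρ → ¬ 9 ∣ W.conductorNorm ℤ → BCDT.IsModular W :=
  fun W _ _ ρ hρ hs h9 ↦
    haveI : Fact (Nat.Prime 3) := ⟨Nat.prime_three⟩
    h32 W 3 (hlift3 W ρ hρ (isAbsIrreducibleOverSqrt_neg_three_of_surjective ρ hs) h9 (hmod3 W ρ hρ hs))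

/-- **F0 — the Frey line on the surjective half only** (PROVED modulo the F-helpers and the proved H0/N1):
the skeleton's `isModular_freyCurve_of_stubs` with (i) `h1` in surjective form, (ii) the switch in the
Shepherd-Barron–Taylor surjective form, and (iii) case A's non-surjective sub-case routed through
F1 ⇒ F2 ⇒ F4 (the CM corner, closed by S13) instead of the dihedral half of Langlands–Tunnell. -/
theorem isModular_freyCurve_of_surjStubs
    (h1 : ∀ (W : WeierstrassCurve ℚ) [W.IsElliptic] [NeZero (W.conductorNorm ℤ)]
      (ρ : ModPGaloisRep ℚ (ZMod 3) 2), W.IsTorsionGaloisRep 3 ρ →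
      Function.Surjective ρ → ¬ 9 ∣ W.conductorNorm ℤ → BCDT.IsModular W)
    (h2 : ∀ (W : WeierstrassCurve ℚ) [W.IsElliptic] [NeZero (W.conductorNorm ℤ)],
      ¬ 25 ∣ W.conductorNorm ℤ →
      ∀ (ρ : ModPGaloisRep ℚ (ZMod 5) 2), W.IsTorsionGaloisRep 5 ρ →
      ρ.IsAbsIrreducibleOverSqrt 5 → ρ.IsModular → BCDT.IsModular W)
    (hSBT : exists_isTorsionGaloisRep_five_and_surjective_three)
    (h4a : ∀ a b : ℤ, IsCoprime a b → a * b * (a + b) ≠ 0 →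
      ∀ ρ : ModPGaloisRep ℚ (ZMod 5) 2, (freyCurve a b).IsTorsionGaloisRep 5 ρ →
        FramedRep.IsIrreducible ρ)
    (h4b : ∀ (W : WeierstrassCurve ℚ) [W.IsElliptic], ¬ 25 ∣ W.conductorNorm ℤ →
      ∀ ρ : ModPGaloisRep ℚ (ZMod 5) 2, W.IsTorsionGaloisRep 5 ρ →
        FramedRep.IsIrreducible ρ → ρ.IsAbsIrreducibleOverSqrt 5)
    (h6 : ∀ (W W' : WeierstrassCurve ℚ) [W.IsElliptic] [W'.IsElliptic]
      (ρ : ModPGaloisRep ℚ (ZMod 5) 2),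
      W.IsTorsionGaloisRep 5 ρ → W'.IsTorsionGaloisRep 5 ρ →
      ¬ 9 ∣ W.conductorNorm ℤ → ¬ 9 ∣ W'.conductorNorm ℤ)
    {a b : ℤ} (hab : IsCoprime a b) (h0 : a * b * (a + b) ≠ 0)
    [NeZero ((freyCurve a b).conductorNorm ℤ)]
    -- tree theorems (`Summit.ABC.ABC.Theorems.not_nine_dvd_conductorNorm_freyCurve`, skeleton l. 617),
    -- taken as hypotheses only to keep this companion's import closure inside built `Literature`:
    (h9 : ¬ 9 ∣ (freyCurve a b).conductorNorm ℤ) (h25 : ¬ 25 ∣ (freyCurve a b).conductorNorm ℤ) :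
    haveI := isElliptic_freyCurve (a := a) (b := b) h0
    BCDT.IsModular (freyCurve a b) := by
  haveI := isElliptic_freyCurve (a := a) (b := b) h0
  haveI : Fact (Nat.Prime 5) := ⟨by norm_num⟩
  haveI : Fact (Nat.Prime 3) := ⟨Nat.prime_three⟩
  -- case A′: some framed model of `E[3]` is onto `GL₂(𝔽₃)`
  by_cases hA : ∃ ρ₃ : ModPGaloisRep ℚ (ZMod 3) 2,
      (freyCurve a b).IsTorsionGaloisRep 3 ρ₃ ∧ Function.Surjective ρ₃
  · obtain ⟨ρ₃, hρ₃, hs⟩ := hA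
    exact h1 (freyCurve a b) ρ₃ hρ₃ hs h9
  -- case A″: a framed model is absolutely irreducible but not onto ⇒ 2-group ⇒ Δ cube ⇒ corner
  by_cases hA' : ∃ ρ₃ : ModPGaloisRep ℚ (ZMod 3) 2,
      (freyCurve a b).IsTorsionGaloisRep 3 ρ₃ ∧ ρ₃.IsAbsIrreducibleOverSqrt (-3)
  · obtain ⟨ρ₃, hρ₃, h3i⟩ := hA'
    have h2g : IsPGroup 2 ρ₃.toMonoidHom.range := by
      rcases surjective_or_isPGroup_two ρ₃ h3i.isAbsolutelyIrreducible.isIrreducible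
        (isOdd_of_isTorsionGaloisRep_three _ ρ₃ hρ₃) with hs | h2
      · exact absurd ⟨ρ₃, hρ₃, hs⟩ hA
      · exact h2
    have hc : IsCorner a b :=
      isCorner_of_isCube_Δ_freyCurve hab h0 (isCube_Δ_of_isPGroup_two _ ρ₃ hρ₃ h2g)
    exact isModular_freyCurve_of_isCorner hc
  -- case B: no framed model of `E[3]` is absolutely irreducible over `ℚ(√-3)`; work at `5`
  have hB : ∀ ρ₃ : ModPGaloisRep ℚ (ZMod 3) 2, (freyCurve a b).IsTorsionGaloisRep 3 ρ₃ →
      ¬ ρ₃.IsAbsIrreducibleOverSqrt (-3) := fun ρ₃ hρ₃ h3i ↦ hA' ⟨ρ₃, hρ₃, h3i⟩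
  obtain ⟨ρ, hρ⟩ := (freyCurve a b).exists_isTorsionGaloisRep 5
  have hirr : FramedRep.IsIrreducible ρ := h4a a b hab h0 ρ hρ
  have h5 : ρ.IsAbsIrreducibleOverSqrt 5 := h4b (freyCurve a b) h25 ρ hρ hirr
  -- the surjective `3`–`5` switch
  obtain ⟨W', hW', hρ', ρ₃', hρ₃', hs'⟩ := switch_surjective_of_SBT hSBT (freyCurve a b) ρ hρ h5
  haveI := hW'
  haveI : NeZero (W'.conductorNorm ℤ) := ⟨(conductorNorm_pos_holds W').ne'⟩
  have h9' : ¬ 9 ∣ W'.conductorNorm ℤ := h6 (freyCurve a b) W' ρ hρ hρ' h9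
  have hE' : BCDT.IsModular W' := h1 W' ρ₃' hρ₃' hs' h9'
  have hρmod : ρ.IsModular := hE'.isModular_of_isTorsionGaloisRep'' hρ'
  exact h2 (freyCurve a b) h25 ρ hρ h5 hρmod

/-! ## PLAN D⁷ — the 2-group half of the stub AS TYPED from the weight-`≥ 2` CM-newform fact -/

/-- **D0⁷** (L as one item; cut into D1–D3 + D0 in the gen-3 companion `STUB_IDEAS_stub_modThree_1_g3.lean`
ll. 186–268, signatures re-checked against today's tree): on the 2-group branch `σ = Ψ∘ρ̄` is induced from
the IMAGINARY quadratic field `M` cut out by the cyclic index-`2` subgroup of the image; the Teichmüller lift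
of the inducing character has a reciprocity partner `ω` (`artinReciprocity_character_holds`, PROVED) and
`ψ = ω · Ψ₀^{3^r−1}` (`Ψ₀` of type `(m₀, 0)`, everywhere unramified: `exists_hasInfinityType_pos_zero_unramified`,
PROVED) is an algebraic Hecke character of type `(m, 0)`, `m ≥ 2`, with `ψ(ϖ_w) ≡ χ̄(Frob_w) (mod 𝔓)`;
the VENDORED fact `Ribet1977_cmNewform_of_heckeCharacter` (weight `k = m + 1 ≥ 2`; shared with crux
stmt-Langlands-18741) gives a newform whose Hecke polynomials are the induced Frobenius polynomials
(`FramedGaloisRep.hasFrobCharpolyAt_induce`), and reduction mod `𝔓` is `ρ.IsModular` — whose weight `w`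
is FREE (`1 ≤ w`, `BCDTModularity` l. 276).  No weight-one form, no Arthur–Clozel, no Gelbart Prop. 4.2. -/
theorem twoGroupBranch_of_cmFact (hCM : Ribet1977_cmNewform_of_heckeCharacter) : TwoGroupBranch := by
  sorry

/-- ★ The stub as typed from PLAN F's surjective half and PLAN D⁷ (kernel-checked). -/
theorem stubModThree_of_surj_of_cmFact (hS : StubModThreeSurj)
    (hCM : Ribet1977_cmNewform_of_heckeCharacter) : StubModThree :=
  stubModThree_of_surj_of_twoGroup hS (twoGroupBranch_of_cmFact hCM)

end Summit.ABC.ABC.Cruxes.FreyModularity.Sketch.StubModThreeIdeasK1G7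

end
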